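import Summits.CriticalPhenomena.PercolationContinuityZ3.Theorems.Transplant.SkelPhiWinChainS
import HarnessLib

/-!
# D″ node, LEVEL 1 (b): the schedule-generic window chain TRANSFERRED FROM `KitsAt` PER STEP (`lt_real_of_chainS_of_kitsAt`) — the form fed by
# `WinChainData.kitsAt_stepA_win` (`SkelPhiWinChainKits`, plain windows) / `kitsAt_stepA_in` (habitat windows): chain property of length `S.N + 1`,
# `KitsAt` of every enlarged step, rim excess, source bound, last core inside `Ft`, domination ⟹ `1 − ε'' < μA`

builds on p205010 (kernel theorem, internal audit signed; external expert review pending) — nothing in this file uses p205010.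
Lane `prim-bschramm`, seat `prim-bschramm-p1` (gen 9); helper file (`--supports stmt-CriticalPhenomena-4575 --as helper`).
* **`WinChainData.lt_real_of_chainS_of_kitsAt`**.
[cite: KozmaNitzan2024, §4 Lemma 11 (pp. 22–23), Lemma 12 (pp. 23–25), p. 20 (Step IV)]
-/

noncomputable section

open MeasureTheory ProbabilityTheory
open scoped ENNReal

namespace Summit.CriticalPhenomena.PercolationContinuityZ3.Theorems.Transplant

namespace Skelφ

namespace WinChainData

open Literature.Probability.Percolation Literature.Probability.LatticeModels SimpleGraph
open Literature.Probability.Percolation.KozmaNitzan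
open KNLevels ChainPlanar

variable {V : Type} [DecidableEq V] {G' : SimpleGraph V} [G'.LocallyFinite] (P : WinChainData V) (𝒲 : PlanarWindow G') (S : Schedule)

/-- **THE CHAIN TRANSFERRED, from `KitsAt` per step** (the form fed by `kitsAt_stepA_win` / `kitsAt_stepA_in`): the chain property of length
`S.N + 1`, `KitsAt` of every enlarged step, rim excess `≤ η ≤ δ/2`, a source bound towards `B₀ ⊆ X^{(0)}_0`, the last core inside `Ft` and
`P_{W'}(⋃ t ∈ Ft, o ↔ t) ≤ μA` give `1 − ε'' < μA`. [cite: KozmaNitzan2024, §4 Lemma 11 (pp. 22–23), Lemma 12 (pp. 23–25), p. 20 (Step IV)] -/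
theorem lt_real_of_chainS_of_kitsAt {p : unitInterval} {W' : Sym2 V → unitInterval} {Ft B₀ : Finset V} {μA : ℝ} {Δ' : ℕ} {δ ε'' η : ℝ}
    (hchain : ∀ (Wg : Sym2 V → unitInterval) (s : Fin (S.N + 1) → TStep G')
      (T' : Fin (S.N + 1) → Finset V) (η : ℝ),
      (∀ i, (s i).L.o = (s 0).L.o) →
      (∀ i : Fin S.N, T' (Fin.castSucc i) ⊆ (s i.succ).L.X 0) →
      (∀ i, T' i ⊆ (s i).T) →
      (∀ i, (s i).KitsAt Wg p Δ' δ) →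
      η ≤ δ / 2 →
      (∀ i, (prodBernoulli Wg).real (⋃ t ∈ (s i).T \ T' i, openConn (s 0).L.o t) ≤ η) →
      1 - δ < (prodBernoulli Wg).real (s 0).L.reachB →
        1 - ε'' < (prodBernoulli Wg).real (⋃ t ∈ T' (Fin.last S.N), openConn (s 0).L.o t))
    (hK : ∀ k ≤ S.N, (P.stepA 𝒲 S k).KitsAt W' p Δ' δ) (hη : η ≤ δ / 2)
    (hexc : ∀ k ≤ S.N, (prodBernoulli W').real (⋃ t ∈ P.Rim k, openConn P.o t) ≤ η)
    (hB₀ : B₀ ⊆ (P.stepL 𝒲 S 0).X 0) (hsrc : 1 - δ < (prodBernoulli W').real (⋃ t ∈ B₀, openConn P.o t))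
    (hTn : 𝒲.coreT S S.N ⊆ Ft) (hdom : (prodBernoulli W').real (⋃ t ∈ Ft, openConn P.o t) ≤ μA) :
    1 - ε'' < μA := by
  let s : Fin (S.N + 1) → TStep G' := fun i => P.stepA 𝒲 S i
  let T' : Fin (S.N + 1) → Finset V := fun i => 𝒲.coreT S i
  have hle : ∀ i : Fin (S.N + 1), (i : ℕ) ≤ S.N := fun i => Nat.lt_succ_iff.1 i.2
  refine lt_real_of_chain G' hchain s T' (fun i => P.stepA_o 𝒲 S i) (fun i => ?_) (fun i => P.coreT_subset_coreE 𝒲 S i)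
    (fun i => hK i (hle i)) hη (fun i => ?_) ?_ ?_ hdom
  · -- the true targets link the chain
    show 𝒲.coreT S (Fin.castSucc i) ⊆ (P.stepA 𝒲 S i.succ).L.X 0
    have : ((i.succ : Fin (S.N + 1)) : ℕ) = (Fin.castSucc i : ℕ) + 1 := by simp
    rw [show P.stepA 𝒲 S (i.succ : ℕ) = P.stepA 𝒲 S ((Fin.castSucc i : ℕ) + 1) by rw [this]]
    exact P.coreT_subset_X_zero_succ 𝒲 S _
  · -- the excess of the enlarged target is inside the rim part
    refine le_trans (measureReal_mono ?_ (measure_ne_top _ _)) (hexc i (hle i))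
    intro ω hω
    simp only [Set.mem_iUnion, exists_prop] at hω ⊢
    obtain ⟨t, ht, hωt⟩ := hω
    exact ⟨t, P.coreE_sdiff_subset 𝒲 S i ht, hωt⟩
  · -- the source bound: `B₀ ⊆ X^{(0)}_0`
    show 1 - δ < (prodBernoulli W').real (P.stepA 𝒲 S ((0 : Fin (S.N + 1)) : ℕ)).L.reachB
    rw [Fin.val_zero]
    refine hsrc.trans_le (measureReal_mono ?_ (measure_ne_top _ _))
    intro ω hω
    simp only [Set.mem_iUnion, exists_prop] at hω
    obtain ⟨t, ht, hωt⟩ := hω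
    show ω ∈ (P.stepL 𝒲 S 0).reachB
    exact Set.mem_biUnion (Finset.mem_coe.2 (hB₀ ht)) hωt
  · -- the last core lies in `Ft`
    show 𝒲.coreT S ((Fin.last S.N : Fin (S.N + 1)) : ℕ) ⊆ Ft
    rw [Fin.val_last]; exact hTn

end WinChainData

end Skelφ

end Summit.CriticalPhenomena.PercolationContinuityZ3.Theorems.Transplant

end
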